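import Summits.BirchSwinnertonDyer.BirchSwinnertonDyer.Theses.LeadingTerm
import Literature.NumberTheory.EllipticCurves.IwasawaLeadingTerm
import Literature.NumberTheory.EllipticCurves.IwasawaOrderKernelRankProofs
import Literature.NumberTheory.EllipticCurves.SelmerCorankControl
import Literature.NumberTheory.EllipticCurves.SelmerCorankHolds
import Literature.NumberTheory.EllipticCurves.PAdicBSD

/-!
# BirchSwinnertonDyer / LeadingTerm — crux `PinchPrime` (stmt-BirchSwinnertonDyer-16218),
# line `SketchIdeator2`, stub `stub_semisimpleOfSchneiderAt` (GLUE, v6: Schneider at `p` ⟹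
# semisimplicity of `T` at `0` on `ℚ_p ⊗ X(E/ℚ_∞)`, pointwise)

Registered stub of the lead skeleton `Cruxes/PinchPrime/Lines/SketchIdeator2.lean` (v6): the
POINTWISE MONOTONICITY lemma showing that the line's open height-side stub
(`stub_semisimpleInfinitelyOften`: `ker T² = ker T` on `V = ℚ_p ⊗_{ℤ_p} X(E/ℚ_∞)`, Greenberg's
Conjecture 1.12 at `T = 0`) is implied, prime by prime, by Schneider's conjecture. For an elliptic
curve `E/ℚ` (globally minimal `W`), a good ordinary prime `p ≥ 5`, the cyclotomic `ℤ_p`-extension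
datum `κ` with a normalised topological generator `γ`, and an Iwasawa datum
`D : W.SelmerDualData κ γ` (`X = D.X = Hom(Sel_{p^∞}(E/ℚ_∞), ℚ_p/ℤ_p)`, `T = γ - 1`) with `X`
finitely generated and `Λ`-torsion: **if `Ш(E/ℚ)[p^∞]` is finite and the canonical cyclotomic
`p`-adic height is non-degenerate (`Reg_p(E, Dh) ≠ 0` for a canonical datum `Dh`,
`WeierstrassCurve.SchneiderConjecture Dh`), then multiplication by `T` on `V` is semisimple at
`0`: `ker T² = ker T`** — the CONVERSE direction of the landed sibling `stub_semisimpleOrder`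
(`Theorems/LeadingTermPinchPrimeSemisimpleOrder.lean`).

The two deep inputs are HYPOTHESES (named tree facts, unproved in the tree):
* `Schneider1985_order_charGenerator` (Perrin-Riou–Schneider, as printed in
  Balakrishnan–Müller–Stein, Math. Comp. 85 (2016), Thm. 1.7), clause 2: for `X` finitely
  generated torsion with `char X = (f_E)`, `ord_{T=0} f_E = rank_ℤ E(ℚ)` iff `Reg_p ≠ 0` and
  `Ш[p^∞]` is finite;
* `Greenberg1999_coinvariantsRank_eq_selmerCorank_rat` (Mazur's control theorem in corank form,
  Greenberg LNM 1716 Thm. 1.2 / Mazur 1972 §6): `rank_{ℤ_p} X/TX = corank_{ℤ_p} Sel_{p^∞}(E/ℚ)`.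

Proof (glue over proved tree theorems; the squeeze of the skeleton's
`semisimple_and_shaCorank_eq_zero_of_order_eq_rank`):
* `char_Λ X` is principal (PROVED, `charIdeal_isPrincipal_holds`, Washington §13.2): pick `f_E`;
* PRS clause 2 (hypothesis): Schneider at `p` ∧ `Ш[p^∞]` finite ⟹ `ord_T f_E = rank`;
* `corank Sel_{p^∞}(E/ℚ) ≤ ord_T f_E` (PROVED, `selmerCorank_le_order_charGenerator`: control +
  the structure-theorem inequality `rank X/TX ≤ ord_T g` for `g ∈ char X`);
* Kummer theory (PROVED, `WeierstrassCurve.selmerCorank_eq_mordellWeilRank_add_holds`,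
  Greenberg 1999 §1): `corank Sel_{p^∞}(E/ℚ) = rank + corank Ш[p^∞]`, so the squeeze
  `rank ≤ rank + corank Ш = corank Sel ≤ ord_T f_E = rank` gives `corank Sel = rank`;
* control (hypothesis) then gives `ord_T f_E = rank_{ℤ_p} X/TX`, which is EQUIVALENT to
  `ker T² = ker T` on `V` (PROVED, `IwasawaAlgebra.order_charGenerator_eq_coinvariantsRank_iff`,
  Greenberg LNM 1716 §1 p. 9, paragraph after Conj. 1.12; Washington Thm. 13.12).

Sources: R. Greenberg, *Iwasawa theory for elliptic curves*, LNM 1716 (1999), §1 (Thm. 1.2,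
Conj. 1.12 and p. 9 after it); J. Balakrishnan, J. S. Müller, W. Stein, Math. Comp. 85 (2016),
Thm. 1.7; P. Schneider, Invent. Math. 79 (1985); L. Washington, *Introduction to Cyclotomic
Fields*, §13.2; B. Mazur, Invent. Math. 18 (1972), §6.
-/

noncomputable section

set_option linter.dupNamespace false

namespace Summit.BirchSwinnertonDyer.BirchSwinnertonDyer.Cruxes.PinchPrime.FirstLayerStability

open scoped MatrixGroups ModularForm
open CongruenceSubgroup Literature.NumberTheory.EllipticCurves
  Literature.NumberTheory.EllipticCurves.ModularForms
open Summit.BirchSwinnertonDyer.BirchSwinnertonDyer.Theses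

/-- **Schneider at `p` ⟹ semisimplicity of `T` at `0` on `ℚ_p ⊗ X(E/ℚ_∞)`** (stub
`stub_semisimpleOfSchneiderAt` of crux `PinchPrime`, line `SketchIdeator2`). Granted
Perrin-Riou–Schneider (`Schneider1985_order_charGenerator`) and the control theorem in corank form
over `ℚ` (`Greenberg1999_coinvariantsRank_eq_selmerCorank_rat`), both hypotheses: for `E/ℚ`
elliptic with globally minimal model `W`, `p ≥ 5` good ordinary, `κ` the cyclotomic
`ℤ_p`-extension with a normalised topological generator `γ`, a finitely generated torsion Iwasawa
datum `D`, `Ш(E/ℚ)[p^∞]` finite and a canonical height datum `Dh` with `Reg_p(E, Dh) ≠ 0`,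
multiplication by `T` on `ℚ_p ⊗_{ℤ_p} X` satisfies `ker T² = ker T`.
Chain: `char X = (f_E)` (principal); PRS clause 2 gives `ord_T f_E = rank`; squeeze
`rank ≤ rank + corank Ш[p^∞] = corank Sel_{p^∞}(E/ℚ) ≤ ord_T f_E = rank` (Kummer, control +
structure theorem) gives `corank Sel = rank`, hence `ord_T f_E = rank_{ℤ_p} X/TX` (control), which
is equivalent to `ker T² = ker T` (`IwasawaAlgebra.order_charGenerator_eq_coinvariantsRank_iff`).
[cite: GreenbergLNM1716, §1 p. 9 (after Conj. 1.12)]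
[cite: BalakrishnanMullerStein2015, Thm. 1.7] -/
theorem stub_semisimpleOfSchneiderAt :
    Schneider1985_order_charGenerator → Greenberg1999_coinvariantsRank_eq_selmerCorank_rat →
    ∀ (W : WeierstrassCurve ℚ) [W.IsElliptic] [W.IsGloballyMinimal] (p : ℕ) [Fact p.Prime],
      5 ≤ p → IsOrdinaryAt W p →
      ∀ (κ : ZpExtension ℚ p) (γ : Field.absoluteGaloisGroup ℚ),
        κ.IsCyclotomic → κ.IsTopGenerator γ → IsCyclotomicVariable p γ →
      ∀ (D : W.SelmerDualData κ γ) [Module.Finite (IwasawaAlgebra p) D.X], D.IsTorsion →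
      Finite (AddCommGroup.primaryComponent W.sha p) →
      ∀ (Dh : WeierstrassCurve.PAdicHeightData W p), Dh.IsCanonical →
        WeierstrassCurve.SchneiderConjecture Dh →
        LinearMap.ker (IwasawaAlgebra.mulTRat p D.X ∘ₗ IwasawaAlgebra.mulTRat p D.X)
          = LinearMap.ker (IwasawaAlgebra.mulTRat p D.X) := by
  intro hPRS hcontrol W _ _ p _ h5 hord κ γ hκ hγ hγ' D _ hX hsha Dh hDh hSch
  -- (a) a generator of the (principal) characteristic ideal `char_Λ X = (f_E)`
  obtain ⟨fE, hfE⟩ : ∃ fE : IwasawaAlgebra p, D.charIdeal = Ideal.span {fE} := by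
    have hP : (D.charIdeal).IsPrincipal := charIdeal_isPrincipal_holds p D.X
    exact ⟨hP.generator, (Ideal.span_singleton_generator D.charIdeal).symm⟩
  -- (b) Perrin-Riou–Schneider, clause 2: Schneider at `p` ∧ `Ш[p^∞]` finite ⟹ `ord_T f_E = rank`
  have horder : fE.order = W.mordellWeilRank :=
    (Schneider1985_order_charGenerator.order_eq_iff hPRS h5 hord.1 hord.2 hκ hγ hγ' D hX hfE
      hDh).mpr ⟨hSch, hsha⟩
  -- (c) `corank Sel_{p^∞}(E/ℚ) ≤ ord_T f_E = rank` (control + structure theorem)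
  have hle1 : (W.selmerCorank p : ℕ∞) ≤ fE.order :=
    selmerCorank_le_order_charGenerator hcontrol W p hord.1 hord.2 hκ hγ D hX hfE
  rw [horder, Nat.cast_le] at hle1
  -- (d) Kummer theory: `corank Sel_{p^∞}(E/ℚ) = rank + corank Ш[p^∞]`, so `corank Sel = rank`
  have h3 : W.selmerCorank p = W.mordellWeilRank + W.shaCorank p :=
    W.selmerCorank_eq_mordellWeilRank_add_holds p
  have hsel : W.selmerCorank p = W.mordellWeilRank := by omega
  -- (e) control: `rank_{ℤ_p} X/TX = corank Sel`, hence `ord_T f_E = rank_{ℤ_p} X/TX`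
  obtain ⟨-, h2⟩ := hcontrol W p hord.1 hord.2 κ γ hκ hγ D
  have hco : fE.order = (IwasawaAlgebra.coinvariantsRank p D.X : ℕ∞) := by
    rw [h2, hsel, horder]
  -- (f) `ord_T f_E = rank_{ℤ_p} X/TX ↔ ker T² = ker T` on `ℚ_p ⊗ X`
  exact (IwasawaAlgebra.order_charGenerator_eq_coinvariantsRank_iff p hX fE hfE).mp hco

end Summit.BirchSwinnertonDyer.BirchSwinnertonDyer.Cruxes.PinchPrime.FirstLayerStability

end
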